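import Summits.Ventures.Crystal3D.Theorems.StickyWulffConstantPolycrystalWulffBoundGenericShiftShells

/-!
# `PolycrystalWulffBound`, line `PolyDensity`: the RADIAL MASS of the crux's Wulff body inside a ball of
# radius `R ≥ 2` (fourteen caps) and the OUTER-SHELL upper envelope of the cap profile
# (crux `stmt-Ventures-19482`; input of the generic cdf shift `11/20`, thread L-2 of cf-p1 §87.0)

Route `StickyWulffConstant` of the venture `Summits/Ventures/Crystal3D`, second prover lane (poly-p2,
gen 15).  Sequel of `…RadialMass` / `…GenericShiftShells` (third radial shell):

* `volume_fccWulffBody_inter_closedBall_ge` / `volume_cruxWulffBody_inter_closedBall_ge` : for every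
  `R ≥ 2` and every frame `X`,
  `|W(X) ∩ B̄(0,R)| ≥ |B̄(0,R)| − 8·cap_R(√3) − 6·cap_R(2)`, `cap_R(τ) = π(2R³/3 − R²τ + τ³/3)` —
  in cubic coordinates (`W_cubic = {‖y‖_∞ ≤ 2} ∩ {‖y‖₁ ≤ 3}`) a point of the ball outside `W` violates a
  cube constraint (one of the six caps `{2 < ±y_i}`) or the octahedron constraint (one of the eight
  caps `{√3 < ⟪y, s/√3⟫}`); one-sided (subadditivity), valid for all `R ≥ 2`, sharp for `R ≤ √4.5`.
* `volume_cruxWulffBody_cap_le_outerShell` : for `R ≥ 2`, `0 ≤ q ≤ R`, unit `n`: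
  `|W(X) ∩ {q < ⟪y,n⟫}| ≤ cap_R(q) + (32 − (|B̄R| − 8 cap_R(√3) − 6 cap_R(2)))/2`
  (the part of the symmetric piece `W(X) ∖ B̄(0,R)` above a nonnegative level is at most half of it).
At `R = 53/25` the outer mass is `≤ 0.1832` (vs `1.94` beyond radius `2`), which is what sharpens the
tail of the shift certificate from `0.558` (two shells) to `0.520`; the kernel consumer is
`cruxWulffBody_cap_shift_eleven_twentieths` (`…GenericShiftElevenTwentieths`).  Memo P-L2-g15 §2.
WHAT THIS IS NOT: the sharp constant `√5 − √3`; the crux is not claimed.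
-/

noncomputable section

open scoped BigOperators InnerProductSpace ENNReal Pointwise
open MeasureTheory Set

namespace Summit.Ventures.Crystal3D.Theorems

open Summit.Ventures.Crystal3D.Cruxes.TextureLiminf.TexShadow (E3)

open Literature.MathematicalPhysics.StatisticalMechanics (fccStacking fccWulffBody mem_fccWulffBody_iff
  isCompact_fccWulffBody)

/-! ### Fourteen caps: the mass inside a ball of radius `R ≥ 2` -/

/-- In cubic coordinates, for `R ≥ 2`:
`|W_cubic ∩ B̄(0,R)| ≥ (4/3)πR³ − 8·cap_R(√3) − 6·cap_R(2)` with `cap_R(τ) = π(2R³/3 − R²τ + τ³/3)`. -/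
theorem volume_fccWulffBody_inter_closedBall_ge {R : ℝ} (hR : 2 ≤ R) :
    ENNReal.ofReal (4 / 3 * Real.pi * R ^ 3 -
        8 * (Real.pi * (2 * R ^ 3 / 3 - R ^ 2 * Real.sqrt 3 + Real.sqrt 3 ^ 3 / 3)) -
        6 * (Real.pi * (2 * R ^ 3 / 3 - R ^ 2 * 2 + 2 ^ 3 / 3))) ≤
      volume (fccWulffBody ∩ Metric.closedBall (0 : E3) R) := by
  have hRpos : 0 < R := by linarith
  have h3pos : 0 < Real.sqrt 3 := Real.sqrt_pos.2 (by norm_num)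
  have h3sq : Real.sqrt 3 ^ 2 = 3 := Real.sq_sqrt (by norm_num)
  have h3le2 : Real.sqrt 3 ≤ 2 := by
    rw [Real.sqrt_le_left (by norm_num)]; norm_num
  have h3leR : Real.sqrt 3 ≤ R := h3le2.trans hR
  -- the eight octahedron normals `u σ = (±1,±1,±1)/√3`
  set u : (Fin 3 → Bool) → E3 := fun σ =>
    WithLp.toLp 2 fun i => if σ i then (Real.sqrt 3)⁻¹ else -(Real.sqrt 3)⁻¹ with hu
  have huapp : ∀ σ i, u σ i = if σ i then (Real.sqrt 3)⁻¹ else -(Real.sqrt 3)⁻¹ := fun σ i => rfl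
  have husq : ∀ σ i, ‖u σ i‖ ^ 2 = 1 / 3 := by
    intro σ i
    rw [huapp, Real.norm_eq_abs, sq_abs]
    split_ifs
    · rw [inv_pow, h3sq]; norm_num
    · rw [neg_sq, inv_pow, h3sq]; norm_num
  have hunorm : ∀ σ, ‖u σ‖ = 1 := by
    intro σ
    rw [EuclideanSpace.norm_eq, Fin.sum_univ_three, husq, husq, husq]
    norm_num
  -- the six cube normals `±e_i`
  set e : (Fin 3 × Bool) → E3 := fun ib =>
    EuclideanSpace.single ib.1 (if ib.2 then (1 : ℝ) else -1) with he
  have henorm : ∀ ib, ‖e ib‖ = 1 := by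
    rintro ⟨i, b⟩
    cases b <;> simp [he]
  have heT : ∀ (i : Fin 3) (y : E3), ⟪y, e (i, true)⟫_ℝ = y i := by
    intro i y
    rw [he, EuclideanSpace.inner_single_right]
    simp
  have heF : ∀ (i : Fin 3) (y : E3), ⟪y, e (i, false)⟫_ℝ = -y i := by
    intro i y
    rw [he, EuclideanSpace.inner_single_right]
    simp
  -- the cover
  set capO : (Fin 3 → Bool) → Set E3 := fun σ =>
    Metric.closedBall (0 : E3) R ∩ {y : E3 | Real.sqrt 3 < ⟪y, u σ⟫_ℝ} with hcapO
  set capC : (Fin 3 × Bool) → Set E3 := fun ib =>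
    Metric.closedBall (0 : E3) R ∩ {y : E3 | 2 < ⟪y, e ib⟫_ℝ} with hcapC
  have hcover : Metric.closedBall (0 : E3) R ⊆
      (fccWulffBody ∩ Metric.closedBall (0 : E3) R) ∪ ((⋃ σ, capO σ) ∪ ⋃ ib, capC ib) := by
    intro y hy
    by_cases hyW : y ∈ fccWulffBody
    · exact Or.inl ⟨hyW, hy⟩
    right
    rw [mem_fccWulffBody_iff] at hyW
    by_cases hcoord : ∀ i, |y i| ≤ 2
    · -- octahedron constraint violated: a hexagonal cap
      left
      have hsum : 3 < ∑ i, |y i| := by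
        by_contra hcon
        exact hyW ⟨hcoord, not_lt.1 hcon⟩
      set σ : Fin 3 → Bool := fun i => decide (0 ≤ y i) with hσ
      have hys : ∀ j, y j * u σ j = (Real.sqrt 3)⁻¹ * |y j| := by
        intro j
        rw [huapp]
        by_cases hj : 0 ≤ y j
        · have : σ j = true := by rw [hσ]; exact decide_eq_true hj
          rw [if_pos this, abs_of_nonneg hj]; ring
        · have : σ j = false := by rw [hσ]; exact decide_eq_false hj
          rw [this, abs_of_neg (lt_of_not_ge hj)]; simp; ring
      have hinner : ⟪y, u σ⟫_ℝ = (Real.sqrt 3)⁻¹ * ∑ j, |y j| := by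
        have e1 : ⟪y, u σ⟫_ℝ = y 0 * u σ 0 + y 1 * u σ 1 + y 2 * u σ 2 := by
          simp [EuclideanSpace.inner_eq_star_dotProduct, dotProduct, Fin.sum_univ_three, mul_comm]
        rw [e1, hys, hys, hys, Fin.sum_univ_three]; ring
      refine mem_iUnion.2 ⟨σ, hy, ?_⟩
      show Real.sqrt 3 < ⟪y, u σ⟫_ℝ
      rw [hinner]
      have e3 : (Real.sqrt 3)⁻¹ * 3 = Real.sqrt 3 := by
        rw [inv_mul_eq_iff_eq_mul₀ h3pos.ne', ← sq, h3sq]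
      calc Real.sqrt 3 = (Real.sqrt 3)⁻¹ * 3 := e3.symm
        _ < (Real.sqrt 3)⁻¹ * ∑ j, |y j| := mul_lt_mul_of_pos_left hsum (inv_pos.2 h3pos)
    · -- a cube constraint violated: a cube cap
      right
      push Not at hcoord
      obtain ⟨i, hi⟩ := hcoord
      by_cases hpos : 0 ≤ y i
      · refine mem_iUnion.2 ⟨(i, true), hy, ?_⟩
        show 2 < ⟪y, e (i, true)⟫_ℝ
        rw [heT]
        rwa [abs_of_nonneg hpos] at hi
      · refine mem_iUnion.2 ⟨(i, false), hy, ?_⟩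
        show 2 < ⟪y, e (i, false)⟫_ℝ
        rw [heF]
        rwa [abs_of_neg (lt_of_not_ge hpos)] at hi
  -- volumes of the caps
  have hcapOvol : ∀ σ, volume (capO σ) =
      ENNReal.ofReal (Real.pi * (2 * R ^ 3 / 3 - R ^ 2 * Real.sqrt 3 + Real.sqrt 3 ^ 3 / 3)) :=
    fun σ => volume_closedBall_inter_ioi (hunorm σ) hRpos h3leR (by linarith)
  have hcapCvol : ∀ ib, volume (capC ib) =
      ENNReal.ofReal (Real.pi * (2 * R ^ 3 / 3 - R ^ 2 * 2 + 2 ^ 3 / 3)) :=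
    fun ib => volume_closedBall_inter_ioi (henorm ib) hRpos hR (by linarith)
  have hO0 : 0 ≤ Real.pi * (2 * R ^ 3 / 3 - R ^ 2 * Real.sqrt 3 + Real.sqrt 3 ^ 3 / 3) := by
    -- `cap_R(√3) = π (R − √3)² (2R + √3)/3 ≥ 0`
    have hfac : 2 * R ^ 3 / 3 - R ^ 2 * Real.sqrt 3 + Real.sqrt 3 ^ 3 / 3 =
        (R - Real.sqrt 3) ^ 2 * (2 * R + Real.sqrt 3) / 3 := by ring
    rw [hfac]
    exact mul_nonneg Real.pi_pos.le (by positivity)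
  have hC0 : 0 ≤ Real.pi * (2 * R ^ 3 / 3 - R ^ 2 * 2 + 2 ^ 3 / 3) := by
    have hfac : 2 * R ^ 3 / 3 - R ^ 2 * 2 + 2 ^ 3 / 3 = (R - 2) ^ 2 * (2 * R + 2) / 3 := by ring
    rw [hfac]
    exact mul_nonneg Real.pi_pos.le (by positivity)
  have hball : volume (Metric.closedBall (0 : E3) R) = ENNReal.ofReal (4 / 3 * Real.pi * R ^ 3) :=
    volume_closedBall_zero_E3 hRpos.le
  have hkey : ENNReal.ofReal (4 / 3 * Real.pi * R ^ 3) ≤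
      volume (fccWulffBody ∩ Metric.closedBall (0 : E3) R) +
        ENNReal.ofReal (8 * (Real.pi * (2 * R ^ 3 / 3 - R ^ 2 * Real.sqrt 3 + Real.sqrt 3 ^ 3 / 3)) +
          6 * (Real.pi * (2 * R ^ 3 / 3 - R ^ 2 * 2 + 2 ^ 3 / 3))) := by
    calc ENNReal.ofReal (4 / 3 * Real.pi * R ^ 3) = volume (Metric.closedBall (0 : E3) R) := hball.symm
      _ ≤ volume ((fccWulffBody ∩ Metric.closedBall (0 : E3) R) ∪ ((⋃ σ, capO σ) ∪ ⋃ ib, capC ib)) :=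
          measure_mono hcover
      _ ≤ volume (fccWulffBody ∩ Metric.closedBall (0 : E3) R) +
          (volume (⋃ σ, capO σ) + volume (⋃ ib, capC ib)) :=
          (measure_union_le _ _).trans (add_le_add le_rfl (measure_union_le _ _))
      _ ≤ volume (fccWulffBody ∩ Metric.closedBall (0 : E3) R) +
          (∑ σ, volume (capO σ) + ∑ ib, volume (capC ib)) :=
          add_le_add le_rfl (add_le_add ((measure_iUnion_le _).trans (by rw [tsum_fintype]))
            ((measure_iUnion_le _).trans (by rw [tsum_fintype])))
      _ = volume (fccWulffBody ∩ Metric.closedBall (0 : E3) R) +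
          ENNReal.ofReal (8 * (Real.pi * (2 * R ^ 3 / 3 - R ^ 2 * Real.sqrt 3 + Real.sqrt 3 ^ 3 / 3)) +
            6 * (Real.pi * (2 * R ^ 3 / 3 - R ^ 2 * 2 + 2 ^ 3 / 3))) := by
          congr 1
          simp_rw [hcapOvol, hcapCvol]
          rw [Finset.sum_const, Finset.sum_const, Finset.card_univ, Finset.card_univ,
            Fintype.card_fun, Fintype.card_bool, Fintype.card_fin, Fintype.card_prod,
            Fintype.card_fin, Fintype.card_bool]
          simp only [nsmul_eq_mul]
          rw [ENNReal.ofReal_add (mul_nonneg (by norm_num) hO0) (mul_nonneg (by norm_num) hC0),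
            ENNReal.ofReal_mul (by norm_num : (0:ℝ) ≤ 8), ENNReal.ofReal_mul (by norm_num : (0:ℝ) ≤ 6)]
          norm_num
  have hsub : ENNReal.ofReal (4 / 3 * Real.pi * R ^ 3 -
        8 * (Real.pi * (2 * R ^ 3 / 3 - R ^ 2 * Real.sqrt 3 + Real.sqrt 3 ^ 3 / 3)) -
        6 * (Real.pi * (2 * R ^ 3 / 3 - R ^ 2 * 2 + 2 ^ 3 / 3))) =
      ENNReal.ofReal (4 / 3 * Real.pi * R ^ 3) -
        ENNReal.ofReal (8 * (Real.pi * (2 * R ^ 3 / 3 - R ^ 2 * Real.sqrt 3 + Real.sqrt 3 ^ 3 / 3)) +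
          6 * (Real.pi * (2 * R ^ 3 / 3 - R ^ 2 * 2 + 2 ^ 3 / 3))) := by
    rw [← ENNReal.ofReal_sub _ (add_nonneg (mul_nonneg (by norm_num) hO0) (mul_nonneg (by norm_num) hC0))]
    congr 1; ring
  rw [hsub]
  exact tsub_le_iff_right.2 hkey

/-- **Mass inside radius `R ≥ 2`.** For every frame `X`:
`|W(X) ∩ B̄(0,R)| ≥ (4/3)πR³ − 8·cap_R(√3) − 6·cap_R(2)`. -/
theorem volume_cruxWulffBody_inter_closedBall_ge (X : E3 ≃ₗᵢ[ℝ] E3) {R : ℝ} (hR : 2 ≤ R) :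
    ENNReal.ofReal (4 / 3 * Real.pi * R ^ 3 -
        8 * (Real.pi * (2 * R ^ 3 / 3 - R ^ 2 * Real.sqrt 3 + Real.sqrt 3 ^ 3 / 3)) -
        6 * (Real.pi * (2 * R ^ 3 / 3 - R ^ 2 * 2 + 2 ^ 3 / 3))) ≤
      volume ({y : E3 | ∀ ν : E3, ⟪y, ν⟫_ℝ ≤ Real.sqrt 2 / 4 *
        ∑ᶠ w ∈ {w | w ∈ fccStacking 1 (Real.sqrt (2 / 3)) ∧ ‖w‖ = 1}, |⟪w, X.symm ν⟫_ℝ|} ∩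
        Metric.closedBall (0 : E3) R) := by
  obtain ⟨L, hL⟩ := exists_linearIsometryEquiv_unitShell_eq
  rw [cruxWulffBody_eq_image_fccWulffBody hL X]
  set Φ : E3 ≃ₗᵢ[ℝ] E3 := L.trans X with hΦ
  have himage : Φ '' fccWulffBody ∩ Metric.closedBall (0 : E3) R =
      Φ '' (fccWulffBody ∩ Metric.closedBall (0 : E3) R) := by
    ext y
    simp only [mem_inter_iff, mem_image, Metric.mem_closedBall, dist_zero_right]
    constructor
    · rintro ⟨⟨x, hx, rfl⟩, hy⟩
      exact ⟨x, ⟨hx, by rwa [LinearIsometryEquiv.norm_map] at hy⟩, rfl⟩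
    · rintro ⟨x, ⟨hx, hx2⟩, rfl⟩
      exact ⟨⟨x, hx, rfl⟩, by rwa [LinearIsometryEquiv.norm_map]⟩
  have hmeas : MeasurableSet (fccWulffBody ∩ Metric.closedBall (0 : E3) R) :=
    isCompact_fccWulffBody.isClosed.measurableSet.inter Metric.isClosed_closedBall.measurableSet
  rw [himage, LinearIsometryEquiv.image_eq_preimage_symm,
    Φ.symm.measurePreserving.measure_preimage hmeas.nullMeasurableSet]
  exact volume_fccWulffBody_inter_closedBall_ge hR

/-! ### The outer-shell upper envelope -/

/-- **Outer-shell upper envelope.** For every frame `X`, unit `n`, radius `R ≥ 2` and `0 ≤ q ≤ R`: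
`|W(X) ∩ {q < ⟪y,n⟫}| ≤ cap_R(q) + (32 − ((4/3)πR³ − 8 cap_R(√3) − 6 cap_R(2)))/2` — the ball cap of
`B̄(0,R)` plus half the (one-sided bound on the) mass of `W(X)` outside `B̄(0,R)`. -/
theorem volume_cruxWulffBody_cap_le_outerShell (X : E3 ≃ₗᵢ[ℝ] E3) {n : E3} (hn : ‖n‖ = 1) {R q : ℝ}
    (hR : 2 ≤ R) (hq0 : 0 ≤ q) (hqR : q ≤ R) :
    volume ({y : E3 | ∀ ν : E3, ⟪y, ν⟫_ℝ ≤ Real.sqrt 2 / 4 *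
        ∑ᶠ w ∈ {w | w ∈ fccStacking 1 (Real.sqrt (2 / 3)) ∧ ‖w‖ = 1}, |⟪w, X.symm ν⟫_ℝ|} ∩
        {y : E3 | q < ⟪y, n⟫_ℝ}) ≤
      ENNReal.ofReal (Real.pi * (2 * R ^ 3 / 3 - R ^ 2 * q + q ^ 3 / 3) +
        (32 - (4 / 3 * Real.pi * R ^ 3 -
          8 * (Real.pi * (2 * R ^ 3 / 3 - R ^ 2 * Real.sqrt 3 + Real.sqrt 3 ^ 3 / 3)) -
          6 * (Real.pi * (2 * R ^ 3 / 3 - R ^ 2 * 2 + 2 ^ 3 / 3)))) / 2) := by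
  set body : Set E3 := {y : E3 | ∀ ν : E3, ⟪y, ν⟫_ℝ ≤ Real.sqrt 2 / 4 *
    ∑ᶠ w ∈ {w | w ∈ fccStacking 1 (Real.sqrt (2 / 3)) ∧ ‖w‖ = 1}, |⟪w, X.symm ν⟫_ℝ|} with hbody
  set m : ℝ := 4 / 3 * Real.pi * R ^ 3 -
      8 * (Real.pi * (2 * R ^ 3 / 3 - R ^ 2 * Real.sqrt 3 + Real.sqrt 3 ^ 3 / 3)) -
      6 * (Real.pi * (2 * R ^ 3 / 3 - R ^ 2 * 2 + 2 ^ 3 / 3)) with hm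
  have hRpos : 0 < R := by linarith
  have hWm : MeasurableSet body := (isCompact_cruxWulffBody X).isClosed.measurableSet
  have hWneg : -body = body := neg_cruxWulffBody_eq X
  have hWvol : volume body = ENNReal.ofReal 32 := volume_cruxWulffBody X
  set BR : Set E3 := Metric.closedBall (0 : E3) R with hBR
  have hBRm : MeasurableSet BR := Metric.isClosed_closedBall.measurableSet
  set S : Set E3 := body \ BR with hS
  have hSm : MeasurableSet S := hWm.diff hBRm
  have hSneg : -S = S := by
    ext y
    simp only [hS, Set.mem_neg, mem_sdiff, hBR, Metric.mem_closedBall, dist_zero_right, norm_neg]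
    constructor
    · rintro ⟨hy, hb⟩
      exact ⟨by have h2 : y ∈ -body := hy; rwa [hWneg] at h2, hb⟩
    · rintro ⟨hy, hb⟩
      exact ⟨by rw [← hWneg] at hy; exact hy, hb⟩
  have hsplit : body ∩ {y : E3 | q < ⟪y, n⟫_ℝ} ⊆ (BR ∩ {y : E3 | q < ⟪y, n⟫_ℝ}) ∪ (S ∩ {y : E3 | q < ⟪y, n⟫_ℝ}) := by
    rintro y ⟨hy, hq⟩
    by_cases hb : y ∈ BR
    · exact Or.inl ⟨hb, hq⟩
    · exact Or.inr ⟨⟨hy, hb⟩, hq⟩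
  have hcap : volume (BR ∩ {y : E3 | q < ⟪y, n⟫_ℝ}) =
      ENNReal.ofReal (Real.pi * (2 * R ^ 3 / 3 - R ^ 2 * q + q ^ 3 / 3)) :=
    volume_closedBall_inter_ioi hn hRpos hqR (by linarith)
  -- the mass outside `B̄(0,R)` : `|S| = 32 − |body ∩ BR| ≤ 32 − m`  (as real numbers: `m` may a priori be anything)
  have hfin : volume (body ∩ BR) ≠ ⊤ :=
    (lt_of_le_of_lt (measure_mono inter_subset_left) (by rw [hWvol]; exact ENNReal.ofReal_lt_top)).ne
  have hSeq : volume S = ENNReal.ofReal 32 - volume (body ∩ BR) := by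
    have hdiff : S = body \ (body ∩ BR) := by rw [hS, Set.sdiff_self_inter]
    rw [hdiff, measure_sdiff inter_subset_left (hWm.inter hBRm).nullMeasurableSet hfin, hWvol]
  have hmle : ENNReal.ofReal m ≤ volume (body ∩ BR) := volume_cruxWulffBody_inter_closedBall_ge X hR
  have hSfin : volume S ≠ ⊤ := by rw [hSeq]; exact ENNReal.sub_ne_top ENNReal.ofReal_ne_top
  -- in reals
  have hSreal : (volume S).toReal ≤ 32 - m := by
    have h1 : (volume S).toReal = 32 - (volume (body ∩ BR)).toReal := by
      rw [hSeq, ENNReal.toReal_sub_of_le ((measure_mono inter_subset_left).trans hWvol.le) ENNReal.ofReal_ne_top,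
        ENNReal.toReal_ofReal (by norm_num)]
    have h2 : m ≤ (volume (body ∩ BR)).toReal := by
      by_cases hm0 : 0 ≤ m
      · have := ENNReal.toReal_mono hfin hmle
        rwa [ENNReal.toReal_ofReal hm0] at this
      · exact (le_of_lt (lt_of_not_ge hm0)).trans ENNReal.toReal_nonneg
    linarith
  have hhalf : (volume (S ∩ {y : E3 | q < ⟪y, n⟫_ℝ})).toReal ≤ (32 - m) / 2 := by
    have h2 := two_mul_volume_inter_ioi_le_of_symm hSneg hSm n hq0
    have hfin2 : volume (S ∩ {y : E3 | q < ⟪y, n⟫_ℝ}) ≠ ⊤ :=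
      (lt_of_le_of_lt (measure_mono inter_subset_left) hSfin.lt_top).ne
    have h3 := ENNReal.toReal_mono hSfin h2
    rw [ENNReal.toReal_mul, ENNReal.toReal_ofNat] at h3
    linarith
  have hcap0 : 0 ≤ Real.pi * (2 * R ^ 3 / 3 - R ^ 2 * q + q ^ 3 / 3) := by
    have hfac : 2 * R ^ 3 / 3 - R ^ 2 * q + q ^ 3 / 3 = (R - q) ^ 2 * (2 * R + q) / 3 := by ring
    rw [hfac]
    exact mul_nonneg Real.pi_pos.le (by positivity)
  have hm0 : 0 ≤ (32 - m) / 2 := by linarith [ENNReal.toReal_nonneg (a := volume S)]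
  have hfinT : volume (S ∩ {y : E3 | q < ⟪y, n⟫_ℝ}) ≠ ⊤ :=
    (lt_of_le_of_lt (measure_mono inter_subset_left) hSfin.lt_top).ne
  calc volume (body ∩ {y : E3 | q < ⟪y, n⟫_ℝ})
      ≤ volume (BR ∩ {y : E3 | q < ⟪y, n⟫_ℝ}) + volume (S ∩ {y : E3 | q < ⟪y, n⟫_ℝ}) :=
        (measure_mono hsplit).trans (measure_union_le _ _)
    _ ≤ ENNReal.ofReal (Real.pi * (2 * R ^ 3 / 3 - R ^ 2 * q + q ^ 3 / 3)) +
        ENNReal.ofReal ((32 - m) / 2) := by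
        refine add_le_add hcap.le ?_
        rw [← ENNReal.ofReal_toReal hfinT]
        exact ENNReal.ofReal_le_ofReal hhalf
    _ = ENNReal.ofReal (Real.pi * (2 * R ^ 3 / 3 - R ^ 2 * q + q ^ 3 / 3) + (32 - m) / 2) :=
        (ENNReal.ofReal_add hcap0 hm0).symm

end Summit.Ventures.Crystal3D.Theorems

end
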